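import Summits.BirchSwinnertonDyer.BirchSwinnertonDyer.Theorems.SmallImageMuTransferMuTransferX9StepOneSahJoint
import Literature.NumberTheory.EllipticCurves.IwasawaTwistModPTowerTopConst
import HarnessLib

/-!
# Step 1 of the `μ`-transfer core (`stub_coreX9`, crux 19276): both images on the joint kernel

HOME/koly/MU-TRANSFER-PROOF.md §5 STEP 1, second half ("`T^{e−1}h^* ≠ 0` forces
`im h^* = 𝒯_e^*`") and the joint form: for a cocycle `ψ` of a twist `𝒯_{J+1}(E, κ₁)` (any
`ℤ_p`-extension `κ₁`, e.g. `κ.invTwist` for the dual deformation) whose class `c` has `T^J c ≠ 0`,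
the constant-coefficient class is non-zero (tree `map_constCoeff_ne_zero_of_shiftH1_iterate_ne_zero`),
so on any normal `S` with the Sah property `ψ` has a value with non-zero constant coefficient and
`ψ(S) = 𝒯_{J+1}` (`valueSubgroup_eq_top_of_shiftH1_iterate_ne_zero`). On class X9 (`p ≥ 5`) the
joint kernel `N_{J+1}(κ) ⊓ N_{J+1}(κ')` has the Sah property (`exists_mem_inf_ker_apply_ne_zero`),
giving both "projects onto" statements of the kernel schema on ONE subgroup
(`valueSubgroup_inf_eq_top_of_towerConst_ne_zero`, `valueSubgroup_inf_eq_top_of_shiftH1_iterate_ne_zero`).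

PARTITION (D-0054): X9 (A4) — helper toward `stub_coreX9`; closes none.
-/

set_option linter.dupNamespace false

noncomputable section

open Literature.NumberTheory.EllipticCurves Literature.NumberTheory.GaloisRepresentations Field
  Function

namespace Summit.BirchSwinnertonDyer.BirchSwinnertonDyer.Rank1Residual.LevelE

variable (W : WeierstrassCurve ℚ) [W.IsElliptic] (p : ℕ) [Fact p.Prime]

/-- **`T^J [ψ] ≠ 0 ⟹ ψ(S) = 𝒯_{J+1}`** for a twist `𝒯_{J+1}(E, κ₁)` under `Irr ∧ ¬Surj`, on any
normal `S` acting trivially with the Sah property (dual side of STEP 1 with `κ₁ = κ⁻¹`).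
[cite: Serre1972, §2.4 Prop. 15] [cite: MazurRubin2004, §5.3] -/
theorem valueSubgroup_eq_top_of_shiftH1_iterate_ne_zero (κ₁ : ZpExtension ℚ p)
    (hirr : W.HasIrreducibleModPGaloisRep p) (hns : ¬ W.HasSurjectiveModNGaloisRep p)
    {γ₁ : absoluteGaloisGroup ℚ} (hγ₁ : κ₁.IsTopGenerator γ₁) (J : ℕ)
    (ψ : contOneCocycles (W.modPTwist p κ₁ (J + 1)).toTopRep)
    (hψ : (κ₁.shiftH1 (W.torsionGaloisModule (p : ℤ))
      (fun P : WeierstrassCurve.geomTorsion W (p : ℤ) => AddSubgroup.torsionBy.nsmul P) (J + 1))^[J]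
        (oneCocycleClass (W.modPTwist p κ₁ (J + 1)).toTopRep ψ) ≠ 0)
    (S : Subgroup (absoluteGaloisGroup ℚ)) [S.Normal]
    (hS : ∀ τ ∈ S, ∀ x : (W.modPTwist p κ₁ (J + 1)).toTopRep,
      (W.modPTwist p κ₁ (J + 1)).toTopRep.ρ τ x = x)
    (hSah : ∀ ψ' : contOneCocycles (W.torsionGaloisModule (p : ℤ)).toTopRep,
      oneCocycleClass (W.torsionGaloisModule (p : ℤ)).toTopRep ψ' ≠ 0 → ∃ τ ∈ S, ψ'.1 τ ≠ 0) :
    contOneCocycles.valueSubgroup ψ S hS = ⊤ := by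
  have hc := κ₁.map_constCoeff_ne_zero_of_shiftH1_iterate_ne_zero (W.torsionGaloisModule (p : ℤ))
    (fun P => AddSubgroup.torsionBy.nsmul P) (Nat.succ_pos J) _ hψ
  change galoisCohomology.map _ 1 (oneCocycleClass (κ₁.twistModP (W.torsionGaloisModule (p : ℤ))
      (fun P => AddSubgroup.torsionBy.nsmul P) (J + 1)).toTopRep ψ) ≠ 0 at hc
  rw [ZpExtension.map_oneCocycleClass_twist] at hc
  obtain ⟨τ, hτ, hne⟩ := hSah _ hc
  exact valueSubgroup_eq_top W p κ₁ hirr hns hγ₁ J ψ S hS ⟨τ, hτ, hne⟩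

variable (κ κ' : ZpExtension ℚ p)

/-- **STEP 1 on class X9, `h`-side on the joint kernel**: `φ(N_{J+1}(κ) ⊓ N_{J'}(κ')) = 𝒯_{J+1}(E, κ)`
for `φ` representing `κ'_{J+1}` with `κ̄' ≠ 0` (`p ≥ 5`, `Irr`, `¬Surj`).
[cite: Serre1972, §2.4 Prop. 15] [cite: MazurRubin2004, §5.3] [cite: Sah1968, Prop. 2.7 (b)] -/
theorem valueSubgroup_inf_eq_top_of_towerConst_ne_zero (hp5 : 5 ≤ p)
    (hirr : W.HasIrreducibleModPGaloisRep p) (hns : ¬ W.HasSurjectiveModNGaloisRep p)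
    {γ : absoluteGaloisGroup ℚ} (hγ : κ.IsTopGenerator γ)
    (y : κ.twistTower (W.torsionGaloisModule (p : ℤ))
      (fun P : WeierstrassCurve.geomTorsion W (p : ℤ) => AddSubgroup.torsionBy.nsmul P))
    (hy : κ.towerConst (W.torsionGaloisModule (p : ℤ)) (fun P => AddSubgroup.torsionBy.nsmul P) y ≠ 0)
    (J J' : ℕ) (φ : contOneCocycles (W.modPTwist p κ (J + 1)).toTopRep)
    (hφ : oneCocycleClass (W.modPTwist p κ (J + 1)).toTopRep φ = y.1 (J + 1)) :
    contOneCocycles.valueSubgroup φ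
      ((κ.twistModPRepresentation (W.torsionGaloisModule (p : ℤ))
          (fun P : WeierstrassCurve.geomTorsion W (p : ℤ) => AddSubgroup.torsionBy.nsmul P) (J + 1)).ker ⊓
        (κ'.twistModPRepresentation (W.torsionGaloisModule (p : ℤ))
          (fun P : WeierstrassCurve.geomTorsion W (p : ℤ) => AddSubgroup.torsionBy.nsmul P) J').ker)
      (fun _ hτ x => κ.toTopRep_ρ_apply_eq_self_of_mem_ker (W.torsionGaloisModule (p : ℤ)) _ (J + 1)
        (Subgroup.mem_inf.mp hτ).1 x) = ⊤ :=
  valueSubgroup_eq_top_of_towerConst_ne_zero W p κ hirr hns hγ y hy J φ hφ _ _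
    (fun ψ hψ => exists_mem_inf_ker_apply_ne_zero W p κ κ' hp5 hirr hns (J + 1) J' ψ hψ)

/-- **STEP 1 on class X9, `h^*`-side on the joint kernel**: `ψ(N_{J}(κ) ⊓ N_{J'+1}(κ')) = 𝒯_{J'+1}(E, κ')`
for a cocycle `ψ` of the `κ'`-twist (e.g. `κ' = κ.invTwist`, the dual deformation) whose class `c`
has `T^{J'} c ≠ 0` (`p ≥ 5`, `Irr`, `¬Surj`). [cite: Serre1972, §2.4 Prop. 15] [cite: MazurRubin2004, §5.3] [cite: Sah1968, Prop. 2.7 (b)] -/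
theorem valueSubgroup_inf_eq_top_of_shiftH1_iterate_ne_zero (hp5 : 5 ≤ p)
    (hirr : W.HasIrreducibleModPGaloisRep p) (hns : ¬ W.HasSurjectiveModNGaloisRep p)
    {γ' : absoluteGaloisGroup ℚ} (hγ' : κ'.IsTopGenerator γ') (J J' : ℕ)
    (ψ : contOneCocycles (W.modPTwist p κ' (J' + 1)).toTopRep)
    (hψ : (κ'.shiftH1 (W.torsionGaloisModule (p : ℤ))
      (fun P : WeierstrassCurve.geomTorsion W (p : ℤ) => AddSubgroup.torsionBy.nsmul P) (J' + 1))^[J']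
        (oneCocycleClass (W.modPTwist p κ' (J' + 1)).toTopRep ψ) ≠ 0) :
    contOneCocycles.valueSubgroup ψ
      ((κ.twistModPRepresentation (W.torsionGaloisModule (p : ℤ))
          (fun P : WeierstrassCurve.geomTorsion W (p : ℤ) => AddSubgroup.torsionBy.nsmul P) J).ker ⊓
        (κ'.twistModPRepresentation (W.torsionGaloisModule (p : ℤ))
          (fun P : WeierstrassCurve.geomTorsion W (p : ℤ) => AddSubgroup.torsionBy.nsmul P) (J' + 1)).ker)
      (fun _ hτ x => κ'.toTopRep_ρ_apply_eq_self_of_mem_ker (W.torsionGaloisModule (p : ℤ)) _ (J' + 1)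
        (Subgroup.mem_inf.mp hτ).2 x) = ⊤ :=
  valueSubgroup_eq_top_of_shiftH1_iterate_ne_zero W p κ' hirr hns hγ' J' ψ hψ _ _
    (fun ψ' hψ' => exists_mem_inf_ker_apply_ne_zero W p κ κ' hp5 hirr hns J (J' + 1) ψ' hψ')

end Summit.BirchSwinnertonDyer.BirchSwinnertonDyer.Rank1Residual.LevelE

end
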